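import Literature.MathematicalPhysics.QuantumFieldTheory.Balaban1983to89.B3Op116RegionSources
import Literature.MathematicalPhysics.QuantumFieldTheory.Balaban1983to89.B3Op116DKernelRegularTorus

/-!
# Bałaban, *(Higgs)₂,₃ quantum fields in a finite volume III. Renormalization* [B3] — THE KERNEL OF THE OPERATOR (1.16) p. 414 AND ITS
ROW DERIVATIVE ON A REGION `Ω ⊆ T_ε` (big-block union), AT INTERIOR POINTS, UNIFORMLY BOUNDED AND EXPONENTIALLY DECAYING for all
`(n, n′)` with `n + n′ + 2 > d` (value) resp. `n + n′ + 1 > d` (derivative) — file R2 of the region twin of the cell's (1.16) programme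
(p35's FILE 4β₂ `B3Op116DKernelRegularTorus` with states controlled at `R₀`-interior points, under print's support hypothesis p. 412)

statement-level skeleton of published theorems with citation tags; proofs where landed; nothing here is a claim about the Yang–Mills mass gap

T. Bałaban, Commun. Math. Phys. **88** (1983) 411–445 [cite: Balaban1983Higgs3]; part I, Commun. Math. Phys. **85** (1982) 603–636
[cite: Balaban1982Higgs1]; [B4] Commun. Math. Phys. **89** (1983) 571–597 [cite: Balaban1983RegularityDecay].  PDFs held:
`paper:balaban1983-higgs-2-3-quantum-fields-finite-volume` (journal page = PDF page + 410; p. 412 = `p0002.txt`, p. 414 = `p0004.txt`, p. 426 =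
`p0016.txt`), `paper:balaban1983-cmp89-regularity-decay` (p. 573 = `p0003.txt`).

CITATION HEADER (lean-in-tree rule).  Cell `lit-balaban` (HOME `run/shared/lean/pub/lit-balaban/`), Phase-2 proof seat **p40** gen 75 (unit
`lit-balaban-p40`; TAKING line HOME/STATUS.md 2026-08-23T09:21:23Z: B3-CLOSURE.md §5 item 20, owner r15, lead g12 word 08:58:08Z).  SKELETON rows
**B3.Eq1.16** (analytic half) / **B3.Eq2.5** — LOCATED MEMBERS, no head claim; decl of record `B3Sect2StatementsPart2.ScaledKernels.Ineq25At` (r15),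
whose general-region binders `hV`, `hDv` of p40 g72's `B3Ineq25Op116Smooth.ineq25At_op116_smooth_of_bounds` (guards `Interior k K₀ Ω`) these
theorems feed.  USED BY NAME, never restated: p35's FILE 4β₁/4β₂ `B3Op116MajorantStep.{maj, stepC, row_step_le, …}`,
`B3Op116DKernelRegularTorus.{cK1, kap4, seqC, rateAt, cvAt, cdAt, valC, derC, seqC_pos, …}` (THE SAME explicit constants as on the torus), r14's
general-region (2.10) dictionary `B3Op116KernelRegularTorus.{col_le_of_ineq210, dcol_le_of_ineq210}` on r15's carrier predicate
`ScaledKernels.Ineq210` over r14's `B3Ineq210RegularRegion.regRegionKernels hL1 C Ω X …` (discharged for big-block unions by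
`B3Ineq210RegularRegion.ineq210_regularRegion_small`, not re-proved here), r14's `B3Op116SourceForm.{srcV, op116_zero_zero_apply,
op116_succ_left_apply, op116_succ_right_apply}` (general `Ω`), p33's `B3Op116MajorantConvolution.majorant_le_top`, and file R1
`B3Op116RegionSources` (`DeepBlk`, `cutV/cutD/cutK`, `norm_mapE_srcV_region_le`).

## What is printed

[B3] p. 414 [PDF 4] (verbatim): *"[G_k(Ω,B̃)V_k(Ã,B̃)]^n G_k(Ω,Ã+B̃)[V_k(Ã,B̃)G_k(Ω,B̃)]^{n′}, (1.16) … for n, n′ sufficiently large, a kernel of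
the operator (1.16) is a sufficiently regular function of both variables. More exactly the Hölder norms of the covariant derivatives of this
kernel … are exponentially decaying with the distance of the arguments and are uniformly bounded by O(1)(e(L^kε)^{1−α})^{n+n′} … This estimate
follows easily from the properties of the propagators G_k(Ω, A) proved in the next paper."*  [B3] p. 412 [PDF 2]: *"we will assume |A|, |∂^ηA|,
|∂^ηB| and their Hölder norms with exponent α₀ are ≦ O(1)p(L^kε) and dist(supp A, ∂Ω) > 2r(L^kε)."*  [B4] p. 573: the kernel bounds hold *"for
x, x′ ∈ Ω, and satisfying the condition dist({x,x′},Ωᶜ) ≧ R₀"*.  [B3] (2.10) p. 426 for `G^η_{(j)}(Ω,B̃;x,x′)`.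

## What this file proves, and how

THE REGION STATE `J` of a field `w` w.r.t. a source point `x′`: `‖w(y)‖ ≤ 𝔪_k(cvAt J, 2+J; δ_J)(y,x′)` for every INTERIOR `y` and
`‖(D^ε_Bw)(b)‖ ≤ 𝔪_k(cdAt J, 1+J; δ_J)(b₋,x′)` for every bond `b` from an INTERIOR `b₋` (p35's state with r14's `Interior k K₀ Ω` guards; nothing
is said at other points, where the cited source gives nothing).  §1 the (2.10) dictionary of `G_k(Ω,X)` at interior pairs for `X = B̃` and
`X = Ã+B̃` (the `D^ε_B`-column of `G_k(Ω,Ã+B̃)` through the split `D_B = D_{Ã+B̃} − M`: the `M_{b₀}`-term is present only on bonds carrying `Ã`,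
whose endpoints are deep, hence interior).  §2 **THE STEP** (`step_fields_region`, `step_state_region`): if `w` is in the region state `J` then
`G_k(Ω,X)V_k(Ã,B̃)w` is in the region state `J+1` for `X ∈ {B̃, Ã+B̃}` — file R1's truncated L-form row (every site/bond function cut to the
interior: under print's support hypothesis the sources of `V_k` sit at deep points, so the cuts lose nothing) fed to p35's ABSTRACT
`row_step_le` with `K = cutK`, `V = cutV`, `D = cutD`; the constants are p35's `stepC(…)` VERBATIM, so the recursion is p35's `seqC`.  §3 **THE
INDUCTION** over the `n + n′` factors (`state_op116_region`, r14's `op116_succ_left/right_apply` on `Ω`) and the unit sources at an interior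
`x′` (`base_state_region`).  §4 **THE THEOREMS** `kernel116_value_le_region` / `kernel116_deriv_le_region`: for `m² > 0`, `a > 0`, `1 ≤ k ≤ K`,
`L ≥ 2`, the (2.10) bounds `Ineq210 δ₁ C` of `G_k(Ω,B̃)` and `G_k(Ω,Ã+B̃)` at interior pairs, `0 < δ₁ ≤ 1`, `sup_b|Ã_b| ≤ s`, `Ã` regular with
`δ_A` AND SUPPORTED ON DEEP BONDS, every `n, n′` with `d < n + n′ + 2` (resp. `+ 1`) and every INTERIOR `x, x′`:
`ε^{−d}Σ_{i′}‖((1.16)^Ω_{n,n′}e_{(x′,i′)})(x)‖ ≤ valC(n+n′)·(L^kε)^{n+n′}·((L^kε)²((L^kε)^d)^{−1})·e^{−δ_{n+n′}|x−x′|/L^k}` and the derivative twin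
with `derC` — EXACTLY the torus bounds of p35, now at print's generality (regions) and in the guarded shape of the general-region assembly.

## Honest scope

Regions `Ω ⊆ T_ε` for which the (2.10) inputs hold at r14-interior pairs (big-block unions: `ineq210_regularRegion_small`); bounds at
interior `x, x′` only ([B4] p. 573's `R₀`-clause); `Ã` vanishes on every bond not having both endpoints in deep blocks (print p. 412 read with
the tree's margin, file R1); `sup|Ã| ≤ s`, `δ_A` global as in FILE 4α/4β₂; `m² > 0`; thresholds = honest order counting as on the torus.  NOT
here: the Hölder clause (region twin of FILE 4γ), the dipole/mixed clauses (region twin of FILE 4M), r15's `Ineq25At` (region (B)/(C)).  No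
`def` at all; no `def … : Prop`, no new named fact; axioms standard.  Value = located engine of a by-reference step of B3 at print's generality,
NOT summit progress.
-/

noncomputable section

open scoped BigOperators

namespace Literature.MathematicalPhysics.QuantumFieldTheory.Balaban1983to89.B3Op116DKernelRegularRegion

open HiggsLattice (ChargeData ScalarField covDeriv)
open HiggsCovariance (propagatorK E)
open HiggsAveraging (blockK blockIter)
open B1Eq230FluctCov (Ix cb)
open B3Ineq210RegularRegion (regRegionKernels Interior)
open B3Op116SourceForm (srcV covDerivAt op116_zero_zero_apply op116_succ_left_apply op116_succ_right_apply)
open B3Op116KernelRegularTorus (col_le_of_ineq210 dcol_le_of_ineq210 norm_covDeriv_le_add_split)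
open B3Op116Pieces (covDeriv_add_split mulM norm_mulM_apply_le)
open B3Op116MajorantStep (maj maj_nonneg maj_rate_mono maj_const_mono maj_add mul_maj maj_shift_left maj_exponent_reduce stepC
  stepC_nonneg row_step_le)
open B3Op116MajorantConvolution (majorant_le_top)
open B3Op116DKernelRegularTorus (cK1 cK1_ge kap4 kap4_nonneg seqC rateAt cvAt cdAt seqC_succ seqC_zero seqC_pos valC derC
  mesh_rpow_split_two mesh_rpow_split_one rate_div_eq)
open B3Op116RegionSources (DeepBlk cutV cutD cutK cutV_nonneg cutD_nonneg cutK_nonneg cutV_le_of cutD_le_of cutK_le_of cutK_of_interior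
  norm_mapE_srcV_region_le)
open B3Eq116TwoSidedExpansion (op116)

variable {P : HiggsLattice.Params} {N : ℕ}

/-! ## §1 The (2.10) dictionary of `G_k(Ω,X)` at interior pairs, in the currency `𝔪` -/

section Dictionary

variable {C : ChargeData N} {A B X : HiggsLattice.VecField P 0} {msq a : ℝ} {k K₀ : ℕ} {hL1 : 1 < P.L} {δ₁ Cst : ℝ}
  {Ω : Finset (HiggsLattice.Site P 0)}

/-- **The column of `G_k(Ω,X)` at an interior pair**: `Σ_i‖(G_k(Ω,X)e_{(z,i)})(x)‖ ≤ 𝔪_k(ε^dC, 2; δ₁)(x,z)` (r14's `col_le_of_ineq210`).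
[cite: Balaban1983Higgs3, (2.6) p.424, (2.10) p.426] [cite: Balaban1983RegularityDecay, Theorem p.573] -/
theorem colR_le_maj (h210 : (regRegionKernels hL1 C Ω X msq a k K₀).Ineq210 δ₁ Cst) (hmsq : 0 < msq) (ha : 0 < a)
    (hk : 1 ≤ k) (hkK : k ≤ P.K) {x z : HiggsLattice.Site P 0} (hx : Interior k K₀ Ω x) (hz : Interior k K₀ Ω z) :
    ∑ i : Ix N, ‖propagatorK C Ω X msq a k (cb P N 0 (z, i)) x‖ ≤ maj P k (P.mesh 0 ^ P.d * Cst) 2 δ₁ x z :=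
  col_le_of_ineq210 C Ω X h210 hmsq ha hk hkK hx hz

/-- **The `D^ε_X`-column of `G_k(Ω,X)` at an interior pair**: `Σ_i‖(D^ε_XG_k(Ω,X)e_{(z,i)})(b₀)‖ ≤ 𝔪_k(ε^dC, 1; δ₁)(b₀₋,z)` (r14's
`dcol_le_of_ineq210`). [cite: Balaban1983Higgs3, (2.6) p.424, (2.10) p.426] [cite: Balaban1983RegularityDecay, Theorem p.573] -/
theorem dcolR_self_le_maj (h210 : (regRegionKernels hL1 C Ω X msq a k K₀).Ineq210 δ₁ Cst) (hmsq : 0 < msq) (ha : 0 < a)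
    (hk : 1 ≤ k) (hkK : k ≤ P.K) {b₀ : HiggsLattice.PBond P 0} {z : HiggsLattice.Site P 0} (hb₀ : Interior k K₀ Ω b₀.src)
    (hz : Interior k K₀ Ω z) :
    ∑ i : Ix N, ‖covDeriv C X (propagatorK C Ω X msq a k (cb P N 0 (z, i))) b₀‖ ≤ maj P k (P.mesh 0 ^ P.d * Cst) 1 δ₁ b₀.src z :=
  dcol_le_of_ineq210 C Ω X h210 hmsq ha hk hkK hb₀ hz

/-- **The `D^ε_B`-column of `G_k(Ω,B̃)` at an interior pair**, with p35's weaker common constant `cK1`. [cite: Balaban1983Higgs3, (2.10) p.426] -/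
theorem dcolR_B_le_maj (h210 : (regRegionKernels hL1 C Ω B msq a k K₀).Ineq210 δ₁ Cst) (hmsq : 0 < msq) (ha : 0 < a)
    (hk : 1 ≤ k) (hkK : k ≤ P.K) (hCst : 0 ≤ Cst) {s : ℝ} (hs : 0 ≤ s) {b₀ : HiggsLattice.PBond P 0} {z : HiggsLattice.Site P 0}
    (hb₀ : Interior k K₀ Ω b₀.src) (hz : Interior k K₀ Ω z) :
    ∑ i : Ix N, ‖covDeriv C B (propagatorK C Ω B msq a k (cb P N 0 (z, i))) b₀‖ ≤ maj P k (cK1 P C k Cst s) 1 δ₁ b₀.src z :=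
  (dcolR_self_le_maj h210 hmsq ha hk hkK hb₀ hz).trans (maj_const_mono (cK1_ge (P := P) (C := C) (k := k) hCst hs).1 b₀.src z)

/-- **The `D^ε_B`-column of `G_k(Ω,Ã+B̃)` at an interior pair**: `Σ_i‖(D^ε_BG_k(Ω,Ã+B̃)e_{(z,i)})(b₀)‖ ≤ 𝔪_k(cK1, 1; δ₁)(b₀₋,z)` through the split
`D^ε_B = D^ε_{Ã+B̃} − M` — the `M_{b₀}`-term appears only when `Ã_{b₀} ≠ 0`, and then `b₀₊` is deep, hence interior, so r14's column bound at
`(b₀₊, z)` is available (p35's `dcol_add_le_maj` on the region). [cite: Balaban1982Higgs1, (3.14) p.614] [cite: Balaban1983Higgs3, (2.10) p.426, p.412] -/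
theorem dcolR_add_le_maj (h210 : (regRegionKernels hL1 C Ω (A + B) msq a k K₀).Ineq210 δ₁ Cst) (hmsq : 0 < msq) (ha : 0 < a)
    (hk : 1 ≤ k) (hkK : k ≤ P.K) (hδ₁ : 0 < δ₁) (hδ₁1 : δ₁ ≤ 1) (hCst : 0 ≤ Cst) {s : ℝ} (hs : 0 ≤ s)
    (hA : ∀ b : HiggsLattice.PBond P 0, |A b| ≤ s)
    (hAS : ∀ b : HiggsLattice.PBond P 0, A b ≠ 0 → DeepBlk k K₀ Ω b.src ∧ DeepBlk k K₀ Ω b.tgt)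
    {b₀ : HiggsLattice.PBond P 0} {z : HiggsLattice.Site P 0} (hb₀ : Interior k K₀ Ω b₀.src) (hz : Interior k K₀ Ω z) :
    ∑ i : Ix N, ‖covDeriv C B (propagatorK C Ω (A + B) msq a k (cb P N 0 (z, i))) b₀‖ ≤ maj P k (cK1 P C k Cst s) 1 δ₁ b₀.src z := by
  have hc : 0 ≤ P.mesh 0 ^ P.d * Cst := mul_nonneg (pow_nonneg (P.mesh_pos 0).le _) hCst
  have hes : 0 ≤ |C.e| * s := mul_nonneg (abs_nonneg _) hs
  obtain ⟨hcK, hcK0⟩ := cK1_ge (P := P) (C := C) (k := k) hCst hs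
  have h1 : ∑ i : Ix N, ‖covDeriv C (A + B) (propagatorK C Ω (A + B) msq a k (cb P N 0 (z, i))) b₀‖
      ≤ maj P k (P.mesh 0 ^ P.d * Cst) 1 δ₁ b₀.src z := dcolR_self_le_maj h210 hmsq ha hk hkK hb₀ hz
  by_cases hb : A b₀ = 0
  · -- no multiplier on b₀: D_B = D_{A+B} there
    have e : ∀ f : ScalarField P 0 N, covDeriv C B f b₀ = covDeriv C (A + B) f b₀ := fun f => by
      rw [covDeriv_add_split C A B f b₀, B3Op116RegionSources.mulM_eq_zero C A B hb, _root_.zero_apply, add_zero]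
    simp only [e]
    exact h1.trans (maj_const_mono hcK b₀.src z)
  · -- b₀ carries Ã: its endpoint b₀₊ is deep, hence interior
    have ht : Interior k K₀ Ω b₀.tgt := (hAS b₀ hb).2.interior
    have h2 : ∑ i : Ix N, ‖propagatorK C Ω (A + B) msq a k (cb P N 0 (z, i)) b₀.tgt‖
        ≤ maj P k (Real.exp 1 * (P.mesh 0 ^ P.d * Cst) * P.mesh k) 1 δ₁ b₀.src z := by
      have hA1 : ∑ i : Ix N, ‖propagatorK C Ω (A + B) msq a k (cb P N 0 (z, i)) b₀.tgt‖
          ≤ maj P k (Real.exp 1 * (P.mesh 0 ^ P.d * Cst)) 2 δ₁ b₀.src z :=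
        (colR_le_maj h210 hmsq ha hk hkK ht hz).trans (maj_shift_left hδ₁ hδ₁1 hc b₀.src z b₀.dir)
      have hA3 := maj_exponent_reduce (P := P) (k := k) (a := 2) (δ := δ₁) (mul_nonneg (Real.exp_nonneg 1) hc) b₀.src z
      rw [show (2 : ℝ) - 1 = 1 by norm_num] at hA3
      exact hA1.trans hA3
    calc ∑ i : Ix N, ‖covDeriv C B (propagatorK C Ω (A + B) msq a k (cb P N 0 (z, i))) b₀‖
        ≤ ∑ i : Ix N, (‖covDeriv C (A + B) (propagatorK C Ω (A + B) msq a k (cb P N 0 (z, i))) b₀‖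
            + |C.e| * s * ‖propagatorK C Ω (A + B) msq a k (cb P N 0 (z, i)) b₀.tgt‖) :=
          Finset.sum_le_sum fun i _ => norm_covDeriv_le_add_split C A B (hA b₀) _
      _ = (∑ i : Ix N, ‖covDeriv C (A + B) (propagatorK C Ω (A + B) msq a k (cb P N 0 (z, i))) b₀‖)
            + |C.e| * s * ∑ i : Ix N, ‖propagatorK C Ω (A + B) msq a k (cb P N 0 (z, i)) b₀.tgt‖ := by
          rw [Finset.sum_add_distrib, Finset.mul_sum]
      _ ≤ maj P k (P.mesh 0 ^ P.d * Cst) 1 δ₁ b₀.src z + |C.e| * s * maj P k (Real.exp 1 * (P.mesh 0 ^ P.d * Cst) * P.mesh k) 1 δ₁ b₀.src z :=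
          add_le_add h1 (mul_le_mul_of_nonneg_left h2 hes)
      _ = maj P k (cK1 P C k Cst s) 1 δ₁ b₀.src z := by
          rw [mul_maj, maj_add, cK1]
          ring_nf

end Dictionary

/-! ## §2 The step on fields on a region: `w ↦ G_k(Ω,X)V_k(Ã,B̃)w` preserves the region state and raises the index -/

section Step

variable {C : ChargeData N} {A B X : HiggsLattice.VecField P 0} {msq a : ℝ} {k K₀ : ℕ} {δ₁ Cst s δA : ℝ}
  {Ω : Finset (HiggsLattice.Site P 0)}

/-- **THE STEP ON FIELDS, ON A REGION.**  For `X` with the interior-pair dictionary `Σ_i‖(G_k(Ω,X)e_{(z,i)})(x)‖ ≤ 𝔪_k(c_{K2},2;δ₁)(x,z)`,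
`Σ_i‖(D^ε_BG_k(Ω,X)e_{(z,i)})(b₀)‖ ≤ 𝔪_k(c_{K1},1;δ₁)(b₀₋,z)` (interior `x, z, b₀₋`), `sup_b|Ã_b| ≤ s`, `Ã` regular with `δ_A` and supported on deep
bonds, `1 ≤ k ≤ K`: if `‖w(y)‖ ≤ 𝔪_k(c_v,a_v;δ)(y,x′)` at interior `y` and `‖(D^ε_Bw)(b)‖ ≤ 𝔪_k(c_d,a_v−1;δ)(b₋,x′)` at bonds from interior `b₋`
(`a_v > 1`, `0 < δ ≤ δ₁ ≤ 1`), then `w⁺ = G_k(Ω,X)V_k(Ã,B̃)w` satisfies `‖w⁺(y)‖ ≤ 𝔪_k(stepC(2,…), a_v+1; δ/(4L))(y,x′)` at interior `y` and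
`‖(D^ε_Bw⁺)(b₀)‖ ≤ 𝔪_k(stepC(1,…), a_v; δ/(4L))(b₀₋,x′)` at bonds from interior `b₀₋` — file R1's truncated row + p35's `row_step_le` with
`K = cutK`, `V = cutV`, `D = cutD`. [cite: Balaban1983Higgs3, (1.16) p.414, (2.10) p.426, p.412] [cite: Balaban1982Higgs1, (3.16) p.615] -/
theorem step_fields_region (hL : 1 < P.L) (hk : 1 ≤ k) (hkK : k ≤ P.K) {cK2 cK1' : ℝ} (hcK2 : 0 ≤ cK2) (hcK1 : 0 ≤ cK1')
    (hcolX : ∀ x z : HiggsLattice.Site P 0, Interior k K₀ Ω x → Interior k K₀ Ω z →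
      ∑ i : Ix N, ‖propagatorK C Ω X msq a k (cb P N 0 (z, i)) x‖ ≤ maj P k cK2 2 δ₁ x z)
    (hdcolX : ∀ (b₀ : HiggsLattice.PBond P 0) (z : HiggsLattice.Site P 0), Interior k K₀ Ω b₀.src → Interior k K₀ Ω z →
      ∑ i : Ix N, ‖covDeriv C B (propagatorK C Ω X msq a k (cb P N 0 (z, i))) b₀‖ ≤ maj P k cK1' 1 δ₁ b₀.src z)
    (hδ₁1 : δ₁ ≤ 1) (hs : 0 ≤ s) (hA : ∀ b : HiggsLattice.PBond P 0, |A b| ≤ s) (hδA : 0 ≤ δA)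
    (hregA : ∀ (z : HiggsLattice.Site P 0) (μ ν : Fin P.d), |A ⟨z.shift ν, μ⟩ - A ⟨z, μ⟩| ≤ δA)
    (hAS : ∀ b : HiggsLattice.PBond P 0, A b ≠ 0 → DeepBlk k K₀ Ω b.src ∧ DeepBlk k K₀ Ω b.tgt)
    (i₀ : Ix N) (x' : HiggsLattice.Site P 0) {δ cv cd av : ℝ} (hδ : 0 < δ) (hδδ₁ : δ ≤ δ₁) (hav : 1 < av) (hcv : 0 ≤ cv) (hcd : 0 ≤ cd)
    (w : ScalarField P 0 N) (hV : ∀ y, Interior k K₀ Ω y → ‖w y‖ ≤ maj P k cv av δ y x')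
    (hD : ∀ b, Interior k K₀ Ω b.src → ‖covDeriv C B w b‖ ≤ maj P k cd (av - 1) δ b.src x') :
    (∀ y, Interior k K₀ Ω y → ‖propagatorK C Ω X msq a k (srcV C A B k Ω a w) y‖
        ≤ maj P k (stepC P N k δ 2 av cK2 cv cd (|C.e| * s) ((P.mesh 0)⁻¹ * (|C.e| * δA)) ((|C.e| * s) ^ 2) (kap4 P C k a s))
            (2 + av - 1) (δ / 2 / P.L / 2) y x') ∧
    (∀ b₀ : HiggsLattice.PBond P 0, Interior k K₀ Ω b₀.src →
      ‖covDeriv C B (propagatorK C Ω X msq a k (srcV C A B k Ω a w)) b₀‖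
        ≤ maj P k (stepC P N k δ 1 av cK1' cv cd (|C.e| * s) ((P.mesh 0)⁻¹ * (|C.e| * δA)) ((|C.e| * s) ^ 2) (kap4 P C k a s))
            (1 + av - 1) (δ / 2 / P.L / 2) b₀.src x') := by
  have hδ1 : δ ≤ 1 := hδδ₁.trans hδ₁1
  have hes : 0 ≤ |C.e| * s := mul_nonneg (abs_nonneg _) hs
  have hκ₂ : 0 ≤ (P.mesh 0)⁻¹ * (|C.e| * δA) := mul_nonneg (inv_nonneg.mpr (P.mesh_pos 0).le) (mul_nonneg (abs_nonneg _) hδA)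
  have hκ₄ : 0 ≤ kap4 P C k a s := kap4_nonneg hs
  set m : ℝ := |C.e| * s * P.mesh 0 * (P.d * ((P.L : ℝ) ^ k - 1)) with hm
  have hca : 0 ≤ |B1.aSeq a P.L k| * (P.mesh k)⁻¹ ^ 2 := by positivity
  set G : ScalarField P 0 N →ₗ[ℝ] ScalarField P 0 N := propagatorK C Ω X msq a k with hG
  -- the truncated field data, bounded everywhere by the majorants
  have hVf : ∀ z, cutV k K₀ Ω w z ≤ maj P k cv av δ z x' := cutV_le_of w (fun z => maj_nonneg hcv z x') hV
  have hDf : ∀ b, cutD k K₀ Ω C B w b ≤ maj P k cd (av - 1) δ b.src x' :=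
    cutD_le_of C B w (fun b => maj_nonneg hcd b.src x') hD
  constructor
  · intro y hy
    set T : ScalarField P 0 N →ₗ[ℝ] E N := (LinearMap.proj y : ScalarField P 0 N →ₗ[ℝ] E N) ∘ₗ G with hT
    have hT' : ∀ φ : ScalarField P 0 N, T φ = (G φ) y := fun φ => rfl
    have hrow := norm_mapE_srcV_region_le C A B a k T hkK hs hδA hA hregA hAS w
    rw [hT'] at hrow
    -- the truncated column of G at y is a majorant
    have hK : ∀ z, cutK k K₀ Ω T z ≤ maj P k cK2 2 δ y z := by
      refine cutK_le_of T (fun z => maj_nonneg hcK2 y z) fun z hz => ?_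
      have h := (hcolX y z hy hz).trans (maj_rate_mono hcK2 hδδ₁ y z)
      simpa only [hT', hG] using h
    have hstep := row_step_le (N := N) hL hk hkK hδ hδ1 (by norm_num : (0:ℝ) < 2) hav hcK2 hcv hcd hes hκ₂ (sq_nonneg (|C.e| * s)) hκ₄ i₀
      y x' (cutK k K₀ Ω T) (cutK_nonneg T) hK (cutV k K₀ Ω w) (cutV_nonneg w) hVf (cutD k K₀ Ω C B w) (cutD_nonneg C B w) hDf
    refine hrow.trans (le_trans ?_ hstep)
    refine add_le_add le_rfl (le_of_eq ?_)
    rw [kap4, Finset.mul_sum, Finset.mul_sum]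
    exact Finset.sum_congr rfl fun z _ => by rw [← hm]; ring
  · intro b₀ hb₀
    set T : ScalarField P 0 N →ₗ[ℝ] E N := covDerivAt C B b₀ ∘ₗ G with hT
    have hT' : ∀ φ : ScalarField P 0 N, T φ = covDeriv C B (G φ) b₀ := fun φ => rfl
    have hrow := norm_mapE_srcV_region_le C A B a k T hkK hs hδA hA hregA hAS w
    rw [hT'] at hrow
    have hK : ∀ z, cutK k K₀ Ω T z ≤ maj P k cK1' 1 δ b₀.src z := by
      refine cutK_le_of T (fun z => maj_nonneg hcK1 b₀.src z) fun z hz => ?_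
      have h := (hdcolX b₀ z hb₀ hz).trans (maj_rate_mono hcK1 hδδ₁ b₀.src z)
      simpa only [hT', hG] using h
    have hstep := row_step_le (N := N) hL hk hkK hδ hδ1 (by norm_num : (0:ℝ) < 1) hav hcK1 hcv hcd hes hκ₂ (sq_nonneg (|C.e| * s)) hκ₄
      i₀ b₀.src x' (cutK k K₀ Ω T) (cutK_nonneg T) hK (cutV k K₀ Ω w) (cutV_nonneg w) hVf (cutD k K₀ Ω C B w) (cutD_nonneg C B w) hDf
    refine hrow.trans (le_trans ?_ hstep)
    refine add_le_add le_rfl (le_of_eq ?_)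
    rw [kap4, Finset.mul_sum, Finset.mul_sum]
    exact Finset.sum_congr rfl fun z _ => by rw [← hm]; ring

end Step

/-! ## §3 The induction over the `n + n′` factors `V_k`, with states at interior points -/

section Induction

variable {C : ChargeData N} {A B : HiggsLattice.VecField P 0} {msq a : ℝ} {k K₀ : ℕ} {hL1 : 1 < P.L} {δ₁ Cst s δA δ₀ cv₀ cd₀ : ℝ}
  {Ω : Finset (HiggsLattice.Site P 0)}

variable (hδ₁ : 0 < δ₁) (hδ₁1 : δ₁ ≤ 1) (hCst : 0 ≤ Cst)
  (h210B : (regRegionKernels hL1 C Ω B msq a k K₀).Ineq210 δ₁ Cst)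
  (h210AB : (regRegionKernels hL1 C Ω (A + B) msq a k K₀).Ineq210 δ₁ Cst)
  (hmsq : 0 < msq) (ha : 0 < a) (hk : 1 ≤ k) (hkK : k ≤ P.K) (i₀ : Ix N)
  (hs : 0 ≤ s) (hA : ∀ b : HiggsLattice.PBond P 0, |A b| ≤ s) (hδA : 0 ≤ δA)
  (hregA : ∀ (z : HiggsLattice.Site P 0) (μ ν : Fin P.d), |A ⟨z.shift ν, μ⟩ - A ⟨z, μ⟩| ≤ δA)
  (hAS : ∀ b : HiggsLattice.PBond P 0, A b ≠ 0 → DeepBlk k K₀ Ω b.src ∧ DeepBlk k K₀ Ω b.tgt)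
  (hδ₀ : 0 < δ₀) (hδ₀1 : δ₀ ≤ δ₁) (hcv₀ : 0 ≤ cv₀) (hcd₀ : 0 ≤ cd₀)
  (x' : HiggsLattice.Site P 0)
include hδ₁ hδ₁1 hCst h210B h210AB hmsq ha hk hkK i₀ hs hA hδA hregA hAS hδ₀ hδ₀1 hcv₀ hcd₀

/-- **THE STEP ON THE REGION STATE**: if `w` is in the region state `J` w.r.t. `x′`, then `G_k(Ω,X)V_k(Ã,B̃)w` is in the region state `J + 1`
for `X = B̃` and for `X = Ã + B̃` (same constants `cvAt`, `cdAt`, `rateAt` as on the torus). [cite: Balaban1983Higgs3, (1.16) p.414, (2.10) p.426, p.412] -/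
theorem step_state_region (J : ℕ) (w : ScalarField P 0 N)
    (hV : ∀ y, Interior k K₀ Ω y →
      ‖w y‖ ≤ maj P k (cvAt P N C k a Cst s δA δ₀ cv₀ cd₀ J) (2 + (J : ℝ)) (rateAt P N C k a Cst s δA δ₀ cv₀ cd₀ J) y x')
    (hD : ∀ b : HiggsLattice.PBond P 0, Interior k K₀ Ω b.src →
      ‖covDeriv C B w b‖ ≤ maj P k (cdAt P N C k a Cst s δA δ₀ cv₀ cd₀ J) (1 + (J : ℝ)) (rateAt P N C k a Cst s δA δ₀ cv₀ cd₀ J) b.src x')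
    (X : HiggsLattice.VecField P 0) (hX : X = B ∨ X = A + B) :
    (∀ y, Interior k K₀ Ω y → ‖propagatorK C Ω X msq a k (srcV C A B k Ω a w) y‖
        ≤ maj P k (cvAt P N C k a Cst s δA δ₀ cv₀ cd₀ (J + 1)) (2 + ((J + 1 : ℕ) : ℝ)) (rateAt P N C k a Cst s δA δ₀ cv₀ cd₀ (J + 1)) y x') ∧
    (∀ b₀ : HiggsLattice.PBond P 0, Interior k K₀ Ω b₀.src →
      ‖covDeriv C B (propagatorK C Ω X msq a k (srcV C A B k Ω a w)) b₀‖
        ≤ maj P k (cdAt P N C k a Cst s δA δ₀ cv₀ cd₀ (J + 1)) (1 + ((J + 1 : ℕ) : ℝ)) (rateAt P N C k a Cst s δA δ₀ cv₀ cd₀ (J + 1)) b₀.src x') := by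
  have hL : 1 < P.L := hL1
  obtain ⟨hr0, hrδ, hcv0, hcd0⟩ := seqC_pos (P := P) (N := N) (C := C) (k := k) (a := a) (Cst := Cst) (s := s) (δA := δA) (δ₀ := δ₀)
    (cv₀ := cv₀) (cd₀ := cd₀) hL hδ₀ hδ₀1 hcv₀ hcd₀ hCst hs hδA J
  obtain ⟨e1, e2, e3⟩ := seqC_succ (P := P) (N := N) (C := C) (k := k) (a := a) (Cst := Cst) (s := s) (δA := δA) (δ₀ := δ₀) (cv₀ := cv₀)
    (cd₀ := cd₀) J
  have hc : 0 ≤ P.mesh 0 ^ P.d * Cst := mul_nonneg (pow_nonneg (P.mesh_pos 0).le _) hCst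
  obtain ⟨-, hcK1⟩ := cK1_ge (P := P) (C := C) (k := k) hCst hs
  have hJ : (1 : ℝ) < 2 + (J : ℝ) := by have := (Nat.cast_nonneg J : (0:ℝ) ≤ J); linarith
  have hD' : ∀ b : HiggsLattice.PBond P 0, Interior k K₀ Ω b.src →
      ‖covDeriv C B w b‖ ≤ maj P k (cdAt P N C k a Cst s δA δ₀ cv₀ cd₀ J) (2 + (J : ℝ) - 1) (rateAt P N C k a Cst s δA δ₀ cv₀ cd₀ J) b.src x' := by
    intro b hb; rw [show (2 : ℝ) + (J : ℝ) - 1 = 1 + (J : ℝ) by ring]; exact hD b hb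
  -- the dictionary for X at interior pairs
  have hcolX : ∀ x z : HiggsLattice.Site P 0, Interior k K₀ Ω x → Interior k K₀ Ω z →
      ∑ i : Ix N, ‖propagatorK C Ω X msq a k (cb P N 0 (z, i)) x‖ ≤ maj P k (P.mesh 0 ^ P.d * Cst) 2 δ₁ x z := by
    rcases hX with rfl | rfl
    · exact fun x z hx hz => colR_le_maj h210B hmsq ha hk hkK hx hz
    · exact fun x z hx hz => colR_le_maj h210AB hmsq ha hk hkK hx hz
  have hdcolX : ∀ (b₀ : HiggsLattice.PBond P 0) (z : HiggsLattice.Site P 0), Interior k K₀ Ω b₀.src → Interior k K₀ Ω z →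
      ∑ i : Ix N, ‖covDeriv C B (propagatorK C Ω X msq a k (cb P N 0 (z, i))) b₀‖ ≤ maj P k (cK1 P C k Cst s) 1 δ₁ b₀.src z := by
    rcases hX with rfl | rfl
    · exact fun b₀ z hb₀ hz => dcolR_B_le_maj h210B hmsq ha hk hkK hCst hs hb₀ hz
    · exact fun b₀ z hb₀ hz => dcolR_add_le_maj h210AB hmsq ha hk hkK hδ₁ hδ₁1 hCst hs hA hAS hb₀ hz
  obtain ⟨hv, hd⟩ := step_fields_region (X := X) hL hk hkK hc hcK1 hcolX hdcolX hδ₁1 hs hA hδA hregA hAS i₀ x' hr0 hrδ hJ hcv0 hcd0 w hV hD'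
  have ev : (2 : ℝ) + (2 + (J : ℝ)) - 1 = 2 + ((J + 1 : ℕ) : ℝ) := by push_cast; ring
  have ed : (1 : ℝ) + (2 + (J : ℝ)) - 1 = 1 + ((J + 1 : ℕ) : ℝ) := by push_cast; ring
  constructor
  · intro y hy
    have h := hv y hy
    rw [ev, ← e1, ← e2] at h
    exact h
  · intro b₀ hb₀
    have h := hd b₀ hb₀
    rw [ed, ← e1, ← e3] at h
    exact h

/-- **THE INDUCTION OVER THE FACTORS OF (1.16) ON A REGION.**  If both propagator images `G_k(Ω,B̃)ψ`, `G_k(Ω,Ã+B̃)ψ` of a source `ψ` are in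
the region state `J`, then `(1.16)^Ω_{n,n′}ψ` is in the region state `J + (n + n′)`. [cite: Balaban1983Higgs3, (1.16) p.414, (2.10) p.426, p.412] -/
theorem state_op116_region : ∀ (n' n J : ℕ) (ψ : ScalarField P 0 N),
    (∀ X : HiggsLattice.VecField P 0, (X = B ∨ X = A + B) →
      (∀ y, Interior k K₀ Ω y → ‖propagatorK C Ω X msq a k ψ y‖
          ≤ maj P k (cvAt P N C k a Cst s δA δ₀ cv₀ cd₀ J) (2 + (J : ℝ)) (rateAt P N C k a Cst s δA δ₀ cv₀ cd₀ J) y x') ∧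
      (∀ b₀ : HiggsLattice.PBond P 0, Interior k K₀ Ω b₀.src → ‖covDeriv C B (propagatorK C Ω X msq a k ψ) b₀‖
          ≤ maj P k (cdAt P N C k a Cst s δA δ₀ cv₀ cd₀ J) (1 + (J : ℝ)) (rateAt P N C k a Cst s δA δ₀ cv₀ cd₀ J) b₀.src x')) →
    (∀ y, Interior k K₀ Ω y → ‖op116 C Ω A B msq a k n n' ψ y‖
        ≤ maj P k (cvAt P N C k a Cst s δA δ₀ cv₀ cd₀ (J + (n + n'))) (2 + ((J + (n + n') : ℕ) : ℝ))
            (rateAt P N C k a Cst s δA δ₀ cv₀ cd₀ (J + (n + n'))) y x') ∧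
    (∀ b₀ : HiggsLattice.PBond P 0, Interior k K₀ Ω b₀.src → ‖covDeriv C B (op116 C Ω A B msq a k n n' ψ) b₀‖
        ≤ maj P k (cdAt P N C k a Cst s δA δ₀ cv₀ cd₀ (J + (n + n'))) (1 + ((J + (n + n') : ℕ) : ℝ))
            (rateAt P N C k a Cst s δA δ₀ cv₀ cd₀ (J + (n + n'))) b₀.src x') := by
  intro n'
  induction n' with
  | zero =>
    intro n
    induction n with
    | zero =>
      intro J ψ hψ
      have h := hψ (A + B) (Or.inr rfl)
      simp only [Nat.add_zero, op116_zero_zero_apply]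
      exact h
    | succ n ihn =>
      intro J ψ hψ
      have ih := ihn J ψ hψ
      have e : J + (n + 1 + 0) = (J + (n + 0)) + 1 := by omega
      rw [e]
      simp only [op116_succ_left_apply]
      exact step_state_region hδ₁ hδ₁1 hCst h210B h210AB hmsq ha hk hkK i₀ hs hA hδA hregA hAS hδ₀ hδ₀1 hcv₀ hcd₀ x' (J + (n + 0)) _
        ih.1 ih.2 B (Or.inl rfl)
  | succ n' ih =>
    intro n J ψ hψ
    have hB := hψ B (Or.inl rfl)
    have hψ' : ∀ X : HiggsLattice.VecField P 0, (X = B ∨ X = A + B) →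
        (∀ y, Interior k K₀ Ω y → ‖propagatorK C Ω X msq a k (srcV C A B k Ω a (propagatorK C Ω B msq a k ψ)) y‖
            ≤ maj P k (cvAt P N C k a Cst s δA δ₀ cv₀ cd₀ (J + 1)) (2 + ((J + 1 : ℕ) : ℝ)) (rateAt P N C k a Cst s δA δ₀ cv₀ cd₀ (J + 1)) y x') ∧
        (∀ b₀ : HiggsLattice.PBond P 0, Interior k K₀ Ω b₀.src → ‖covDeriv C B (propagatorK C Ω X msq a k
            (srcV C A B k Ω a (propagatorK C Ω B msq a k ψ))) b₀‖
            ≤ maj P k (cdAt P N C k a Cst s δA δ₀ cv₀ cd₀ (J + 1)) (1 + ((J + 1 : ℕ) : ℝ)) (rateAt P N C k a Cst s δA δ₀ cv₀ cd₀ (J + 1)) b₀.src x') :=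
      fun X hX => step_state_region hδ₁ hδ₁1 hCst h210B h210AB hmsq ha hk hkK i₀ hs hA hδA hregA hAS hδ₀ hδ₀1 hcv₀ hcd₀ x' J _ hB.1 hB.2 X hX
    have h := ih n (J + 1) _ hψ'
    have e : J + (n + (n' + 1)) = J + 1 + (n + n') := by omega
    rw [e]
    simp only [op116_succ_right_apply]
    exact h

end Induction

/-! ## §3b The unit sources at an interior `x′`: the state of `(1.16)^Ω_{n,n′}e_{(x′,i′)}` -/

section UnitSource

variable {C : ChargeData N} {A B : HiggsLattice.VecField P 0} {msq a : ℝ} {k K₀ : ℕ} {hL1 : 1 < P.L} {δ₁ Cst s δA : ℝ}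
  {Ω : Finset (HiggsLattice.Site P 0)}

variable (hδ₁ : 0 < δ₁) (hδ₁1 : δ₁ ≤ 1) (hCst : 0 ≤ Cst)
  (h210B : (regRegionKernels hL1 C Ω B msq a k K₀).Ineq210 δ₁ Cst)
  (h210AB : (regRegionKernels hL1 C Ω (A + B) msq a k K₀).Ineq210 δ₁ Cst)
  (hmsq : 0 < msq) (ha : 0 < a) (hk : 1 ≤ k) (hkK : k ≤ P.K) (i₀ : Ix N)
  (hs : 0 ≤ s) (hA : ∀ b : HiggsLattice.PBond P 0, |A b| ≤ s) (hδA : 0 ≤ δA)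
  (hregA : ∀ (z : HiggsLattice.Site P 0) (μ ν : Fin P.d), |A ⟨z.shift ν, μ⟩ - A ⟨z, μ⟩| ≤ δA)
  (hAS : ∀ b : HiggsLattice.PBond P 0, A b ≠ 0 → DeepBlk k K₀ Ω b.src ∧ DeepBlk k K₀ Ω b.tgt)
  {x' : HiggsLattice.Site P 0} (hx' : Interior k K₀ Ω x')
include hδ₁ hδ₁1 hCst h210B h210AB hmsq ha hk hkK i₀ hs hA hδA hregA hAS hx'

omit i₀ hδA hregA in
/-- **THE UNIT SOURCES AT AN INTERIOR `x′` ARE IN THE REGION STATE 0**: `‖(G_k(Ω,X)e_{(x′,i′)})(y)‖ ≤ Σ_i‖(G_k(Ω,X)e_{(x′,i)})(y)‖` and §1 at the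
interior pair `(y, x′)`; likewise for the `D^ε_B`-columns. [cite: Balaban1983Higgs3, (2.10) p.426] [cite: Balaban1983RegularityDecay, Theorem p.573] -/
theorem base_state_region (i' : Ix N) (X : HiggsLattice.VecField P 0) (hX : X = B ∨ X = A + B) :
    (∀ y, Interior k K₀ Ω y → ‖propagatorK C Ω X msq a k (cb P N 0 (x', i')) y‖
        ≤ maj P k (cvAt P N C k a Cst s δA δ₁ (P.mesh 0 ^ P.d * Cst) (cK1 P C k Cst s) 0) (2 + ((0 : ℕ) : ℝ))
            (rateAt P N C k a Cst s δA δ₁ (P.mesh 0 ^ P.d * Cst) (cK1 P C k Cst s) 0) y x') ∧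
    (∀ b₀ : HiggsLattice.PBond P 0, Interior k K₀ Ω b₀.src → ‖covDeriv C B (propagatorK C Ω X msq a k (cb P N 0 (x', i'))) b₀‖
        ≤ maj P k (cdAt P N C k a Cst s δA δ₁ (P.mesh 0 ^ P.d * Cst) (cK1 P C k Cst s) 0) (1 + ((0 : ℕ) : ℝ))
            (rateAt P N C k a Cst s δA δ₁ (P.mesh 0 ^ P.d * Cst) (cK1 P C k Cst s) 0) b₀.src x') := by
  obtain ⟨e1, e2, e3⟩ := seqC_zero (P := P) (N := N) (C := C) (k := k) (a := a) (Cst := Cst) (s := s) (δA := δA)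
    (δ₀ := δ₁) (cv₀ := P.mesh 0 ^ P.d * Cst) (cd₀ := cK1 P C k Cst s)
  rw [e1, e2, e3, Nat.cast_zero, add_zero, add_zero]
  constructor
  · intro y hy
    have h1 : ‖propagatorK C Ω X msq a k (cb P N 0 (x', i')) y‖ ≤ ∑ i : Ix N, ‖propagatorK C Ω X msq a k (cb P N 0 (x', i)) y‖ :=
      Finset.single_le_sum (f := fun i => ‖propagatorK C Ω X msq a k (cb P N 0 (x', i)) y‖) (fun _ _ => norm_nonneg _)
        (Finset.mem_univ i')
    refine h1.trans ?_
    rcases hX with rfl | rfl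
    · exact colR_le_maj h210B hmsq ha hk hkK hy hx'
    · exact colR_le_maj h210AB hmsq ha hk hkK hy hx'
  · intro b₀ hb₀
    have h1 : ‖covDeriv C B (propagatorK C Ω X msq a k (cb P N 0 (x', i'))) b₀‖
        ≤ ∑ i : Ix N, ‖covDeriv C B (propagatorK C Ω X msq a k (cb P N 0 (x', i))) b₀‖ :=
      Finset.single_le_sum (f := fun i => ‖covDeriv C B (propagatorK C Ω X msq a k (cb P N 0 (x', i))) b₀‖) (fun _ _ => norm_nonneg _)
        (Finset.mem_univ i')
    refine h1.trans ?_
    rcases hX with rfl | rfl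
    · exact dcolR_B_le_maj h210B hmsq ha hk hkK hCst hs hb₀ hx'
    · exact dcolR_add_le_maj h210AB hmsq ha hk hkK hδ₁ hδ₁1 hCst hs hA hAS hb₀ hx'

/-- **THE FIELD `(1.16)^Ω_{n,n′}e_{(x′,i′)}` IS IN THE REGION STATE `n + n′`** (interior `x′`). [cite: Balaban1983Higgs3, (1.16) p.414, (2.10) p.426, p.412] -/
theorem state_op116_cb_region (n n' : ℕ) (i' : Ix N) :
    (∀ y, Interior k K₀ Ω y → ‖op116 C Ω A B msq a k n n' (cb P N 0 (x', i')) y‖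
        ≤ maj P k (cvAt P N C k a Cst s δA δ₁ (P.mesh 0 ^ P.d * Cst) (cK1 P C k Cst s) (n + n')) (2 + ((n + n' : ℕ) : ℝ))
            (rateAt P N C k a Cst s δA δ₁ (P.mesh 0 ^ P.d * Cst) (cK1 P C k Cst s) (n + n')) y x') ∧
    (∀ b₀ : HiggsLattice.PBond P 0, Interior k K₀ Ω b₀.src → ‖covDeriv C B (op116 C Ω A B msq a k n n' (cb P N 0 (x', i'))) b₀‖
        ≤ maj P k (cdAt P N C k a Cst s δA δ₁ (P.mesh 0 ^ P.d * Cst) (cK1 P C k Cst s) (n + n')) (1 + ((n + n' : ℕ) : ℝ))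
            (rateAt P N C k a Cst s δA δ₁ (P.mesh 0 ^ P.d * Cst) (cK1 P C k Cst s) (n + n')) b₀.src x') := by
  have hc : 0 ≤ P.mesh 0 ^ P.d * Cst := mul_nonneg (pow_nonneg (P.mesh_pos 0).le _) hCst
  obtain ⟨-, hcK1⟩ := cK1_ge (P := P) (C := C) (k := k) hCst hs
  have h := state_op116_region hδ₁ hδ₁1 hCst h210B h210AB hmsq ha hk hkK i₀ hs hA hδA hregA hAS hδ₁ le_rfl hc hcK1 x' n' n 0
    (cb P N 0 (x', i')) (fun X hX => base_state_region hδ₁ hδ₁1 hCst h210B h210AB hmsq ha hk hkK hs hA hAS hx' i' X hX)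
  simp only [Nat.zero_add] at h
  exact h

end UnitSource

/-! ## §4 The theorems: the kernel of (1.16) on a region and its row derivative, at interior points, for `n + n′` large -/

section Kernel

variable {C : ChargeData N} {A B : HiggsLattice.VecField P 0} {msq a : ℝ} {k K₀ : ℕ} {hL1 : 1 < P.L} {δ₁ Cst s δA : ℝ}
  {Ω : Finset (HiggsLattice.Site P 0)}

variable (hδ₁ : 0 < δ₁) (hδ₁1 : δ₁ ≤ 1) (hCst : 0 ≤ Cst)
  (h210B : (regRegionKernels hL1 C Ω B msq a k K₀).Ineq210 δ₁ Cst)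
  (h210AB : (regRegionKernels hL1 C Ω (A + B) msq a k K₀).Ineq210 δ₁ Cst)
  (hmsq : 0 < msq) (ha : 0 < a) (hk : 1 ≤ k) (hkK : k ≤ P.K) (i₀ : Ix N)
  (hs : 0 ≤ s) (hA : ∀ b : HiggsLattice.PBond P 0, |A b| ≤ s) (hδA : 0 ≤ δA)
  (hregA : ∀ (z : HiggsLattice.Site P 0) (μ ν : Fin P.d), |A ⟨z.shift ν, μ⟩ - A ⟨z, μ⟩| ≤ δA)
  (hAS : ∀ b : HiggsLattice.PBond P 0, A b ≠ 0 → DeepBlk k K₀ Ω b.src ∧ DeepBlk k K₀ Ω b.tgt)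
include hδ₁ hδ₁1 hCst h210B h210AB hmsq ha hk hkK i₀ hs hA hδA hregA hAS

/-- **THE KERNEL OF (1.16) ON A REGION IS UNIFORMLY BOUNDED AND EXPONENTIALLY DECAYING AT INTERIOR POINTS, FOR ALL `n + n′ + 2 > d`** (print's
*"uniformly bounded … exponentially decaying with the distance of the arguments"* for the VALUE of the kernel, p. 414, at print's general region
`Ω ⊆ T_ε`): for `m² > 0`, `a > 0`, `1 ≤ k ≤ K`, the (2.10) bounds `Ineq210 δ₁ C` of `G_k(Ω,B̃)`, `G_k(Ω,Ã+B̃)` at interior pairs (r14's carrier),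
`sup_b|Ã_b| ≤ s`, `Ã` regular with `δ_A` and supported on deep bonds (print p. 412), every `n, n′` with `d < n + n′ + 2` and every INTERIOR
`x, x′`: `ε^{−d}Σ_{i′}‖((1.16)^Ω_{n,n′}e_{(x′,i′)})(x)‖ ≤ valC(n+n′)·(L^kε)^{n+n′}·((L^kε)²((L^kε)^d)^{−1})·exp(−δ_{n+n′}|x−x′|/L^k)` — the binder `hV`
of p40's general-region `ineq25At_op116_smooth_of_bounds`, with p35's torus constant `valC` verbatim.
[cite: Balaban1983Higgs3, (1.16) p.414, (2.5) p.424, (2.10) p.426, p.412] [cite: Balaban1983RegularityDecay, Theorem p.573] -/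
theorem kernel116_value_le_region (n n' : ℕ) (hd : (P.d : ℝ) < (n + n' : ℕ) + 2) (x x' : HiggsLattice.Site P 0)
    (hx : Interior k K₀ Ω x) (hx' : Interior k K₀ Ω x') :
    (P.mesh 0 ^ P.d)⁻¹ * ∑ i' : Ix N, ‖op116 C Ω A B msq a k n n' (cb P N 0 (x', i')) x‖
      ≤ valC P N C k a δ₁ Cst s δA (n + n') * P.mesh k ^ (n + n') * (P.mesh k ^ 2 * (P.mesh k ^ P.d)⁻¹) *
          Real.exp (-(rateAt P N C k a Cst s δA δ₁ (P.mesh 0 ^ P.d * Cst) (cK1 P C k Cst s) (n + n') *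
            ((HiggsLattice.Site.tdist x x' : ℝ) / (P.L : ℝ) ^ k))) := by
  have hL : 1 < P.L := hL1
  set M := n + n' with hM
  have hc : 0 ≤ P.mesh 0 ^ P.d * Cst := mul_nonneg (pow_nonneg (P.mesh_pos 0).le _) hCst
  obtain ⟨-, hcK1⟩ := cK1_ge (P := P) (C := C) (k := k) hCst hs
  obtain ⟨hr0, -, hcv0, -⟩ := seqC_pos (P := P) (N := N) (C := C) (k := k) (a := a) (Cst := Cst) (s := s) (δA := δA)
    (δ₀ := δ₁) (cv₀ := P.mesh 0 ^ P.d * Cst) (cd₀ := cK1 P C k Cst s) hL hδ₁ le_rfl hc hcK1 hCst hs hδA M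
  have hsM : 0 < (2 : ℝ) + (M : ℝ) - (P.d : ℝ) := by linarith
  have hε : 0 ≤ (P.mesh 0 ^ P.d)⁻¹ := inv_nonneg.mpr (pow_nonneg (P.mesh_pos 0).le _)
  have hpt : ∀ i' : Ix N, ‖op116 C Ω A B msq a k n n' (cb P N 0 (x', i')) x‖
      ≤ cvAt P N C k a Cst s δA δ₁ (P.mesh 0 ^ P.d * Cst) (cK1 P C k Cst s) M / ((P.L : ℝ) ^ ((2 : ℝ) + (M : ℝ) - (P.d : ℝ)) - 1) *
          P.mesh k ^ ((2 : ℝ) + (M : ℝ) - (P.d : ℝ)) *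
          Real.exp (-(rateAt P N C k a Cst s δA δ₁ (P.mesh 0 ^ P.d * Cst) (cK1 P C k Cst s) M * (P.mesh k)⁻¹ *
            (P.mesh 0 * (HiggsLattice.Site.tdist x x' : ℝ)))) := by
    intro i'
    have h := (state_op116_cb_region hδ₁ hδ₁1 hCst h210B h210AB hmsq ha hk hkK i₀ hs hA hδA hregA hAS hx' n n' i').1 x hx
    refine h.trans ?_
    unfold maj
    exact majorant_le_top hL hcv0 hsM hr0.le x x'
  calc (P.mesh 0 ^ P.d)⁻¹ * ∑ i' : Ix N, ‖op116 C Ω A B msq a k n n' (cb P N 0 (x', i')) x‖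
      ≤ (P.mesh 0 ^ P.d)⁻¹ * ∑ _i' : Ix N,
          cvAt P N C k a Cst s δA δ₁ (P.mesh 0 ^ P.d * Cst) (cK1 P C k Cst s) M / ((P.L : ℝ) ^ ((2 : ℝ) + (M : ℝ) - (P.d : ℝ)) - 1) *
            P.mesh k ^ ((2 : ℝ) + (M : ℝ) - (P.d : ℝ)) *
            Real.exp (-(rateAt P N C k a Cst s δA δ₁ (P.mesh 0 ^ P.d * Cst) (cK1 P C k Cst s) M * (P.mesh k)⁻¹ *
              (P.mesh 0 * (HiggsLattice.Site.tdist x x' : ℝ)))) :=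
        mul_le_mul_of_nonneg_left (Finset.sum_le_sum fun i' _ => hpt i') hε
    _ = _ := by
        rw [Finset.sum_const, Finset.card_univ, nsmul_eq_mul, mesh_rpow_split_two, rate_div_eq, valC]
        ring

/-- **THE ROW DERIVATIVE OF THE KERNEL OF (1.16) ON A REGION IS UNIFORMLY BOUNDED AND EXPONENTIALLY DECAYING AT INTERIOR POINTS, FOR ALL
`n + n′ + 1 > d`**: under the hypotheses of `kernel116_value_le_region`, for every `n, n′` with `d < n + n′ + 1`, every bond `⟨x, x+εe_μ⟩` from an
INTERIOR `x` and every INTERIOR `x′`: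
`ε^{−d}Σ_{i′}‖(D^ε_B(1.16)^Ω_{n,n′}e_{(x′,i′)})(⟨x,μ⟩)‖ ≤ derC(n+n′)·(L^kε)^{n+n′}·((L^kε)((L^kε)^d)^{−1})·exp(−δ_{n+n′}|x−x′|/L^k)` — the binder `hDv` of
p40's general-region `ineq25At_op116_smooth_of_bounds`, with p35's torus constant `derC` verbatim.
[cite: Balaban1983Higgs3, (1.16) p.414, (2.5) p.424, (2.10) p.426, p.412] [cite: Balaban1983RegularityDecay, Theorem p.573] -/
theorem kernel116_deriv_le_region (n n' : ℕ) (hd : (P.d : ℝ) < (n + n' : ℕ) + 1) (μ : Fin P.d) (x x' : HiggsLattice.Site P 0)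
    (hx : Interior k K₀ Ω x) (hx' : Interior k K₀ Ω x') :
    (P.mesh 0 ^ P.d)⁻¹ * ∑ i' : Ix N, ‖covDeriv C B (op116 C Ω A B msq a k n n' (cb P N 0 (x', i'))) ⟨x, μ⟩‖
      ≤ derC P N C k a δ₁ Cst s δA (n + n') * P.mesh k ^ (n + n') * (P.mesh k * (P.mesh k ^ P.d)⁻¹) *
          Real.exp (-(rateAt P N C k a Cst s δA δ₁ (P.mesh 0 ^ P.d * Cst) (cK1 P C k Cst s) (n + n') *
            ((HiggsLattice.Site.tdist x x' : ℝ) / (P.L : ℝ) ^ k))) := by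
  have hL : 1 < P.L := hL1
  set M := n + n' with hM
  have hc : 0 ≤ P.mesh 0 ^ P.d * Cst := mul_nonneg (pow_nonneg (P.mesh_pos 0).le _) hCst
  obtain ⟨-, hcK1⟩ := cK1_ge (P := P) (C := C) (k := k) hCst hs
  obtain ⟨hr0, -, -, hcd0⟩ := seqC_pos (P := P) (N := N) (C := C) (k := k) (a := a) (Cst := Cst) (s := s) (δA := δA)
    (δ₀ := δ₁) (cv₀ := P.mesh 0 ^ P.d * Cst) (cd₀ := cK1 P C k Cst s) hL hδ₁ le_rfl hc hcK1 hCst hs hδA M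
  have hsM : 0 < (1 : ℝ) + (M : ℝ) - (P.d : ℝ) := by linarith
  have hε : 0 ≤ (P.mesh 0 ^ P.d)⁻¹ := inv_nonneg.mpr (pow_nonneg (P.mesh_pos 0).le _)
  have hsrc : (⟨x, μ⟩ : HiggsLattice.PBond P 0).src = x := rfl
  have hpt : ∀ i' : Ix N, ‖covDeriv C B (op116 C Ω A B msq a k n n' (cb P N 0 (x', i'))) ⟨x, μ⟩‖
      ≤ cdAt P N C k a Cst s δA δ₁ (P.mesh 0 ^ P.d * Cst) (cK1 P C k Cst s) M / ((P.L : ℝ) ^ ((1 : ℝ) + (M : ℝ) - (P.d : ℝ)) - 1) *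
          P.mesh k ^ ((1 : ℝ) + (M : ℝ) - (P.d : ℝ)) *
          Real.exp (-(rateAt P N C k a Cst s δA δ₁ (P.mesh 0 ^ P.d * Cst) (cK1 P C k Cst s) M * (P.mesh k)⁻¹ *
            (P.mesh 0 * (HiggsLattice.Site.tdist x x' : ℝ)))) := by
    intro i'
    have h := (state_op116_cb_region hδ₁ hδ₁1 hCst h210B h210AB hmsq ha hk hkK i₀ hs hA hδA hregA hAS hx' n n' i').2 ⟨x, μ⟩ hx
    rw [hsrc] at h
    refine h.trans ?_
    unfold maj
    exact majorant_le_top hL hcd0 hsM hr0.le x x'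
  calc (P.mesh 0 ^ P.d)⁻¹ * ∑ i' : Ix N, ‖covDeriv C B (op116 C Ω A B msq a k n n' (cb P N 0 (x', i'))) ⟨x, μ⟩‖
      ≤ (P.mesh 0 ^ P.d)⁻¹ * ∑ _i' : Ix N,
          cdAt P N C k a Cst s δA δ₁ (P.mesh 0 ^ P.d * Cst) (cK1 P C k Cst s) M / ((P.L : ℝ) ^ ((1 : ℝ) + (M : ℝ) - (P.d : ℝ)) - 1) *
            P.mesh k ^ ((1 : ℝ) + (M : ℝ) - (P.d : ℝ)) *
            Real.exp (-(rateAt P N C k a Cst s δA δ₁ (P.mesh 0 ^ P.d * Cst) (cK1 P C k Cst s) M * (P.mesh k)⁻¹ *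
              (P.mesh 0 * (HiggsLattice.Site.tdist x x' : ℝ)))) :=
        mul_le_mul_of_nonneg_left (Finset.sum_le_sum fun i' _ => hpt i') hε
    _ = _ := by
        rw [Finset.sum_const, Finset.card_univ, nsmul_eq_mul, mesh_rpow_split_one, rate_div_eq, derC]
        ring

end Kernel

/-! ## §5 Entry points for other seeds (dipoles, the pure-`B̃` chain) and the two readings of `W = G_k(Ω,Ã+B̃) − G_k(Ω,B̃)` on a region

The region twins of p35's FILE 4β₂ §6/§7 and of `B3Op116HolderKernelRegularTorusZero.state_chainB`, for the region twins of FILE 4γ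
(Hölder, p35) and FILE 4M (mixed, p40): generic seed triple `(δ₀, cv₀, cd₀)`, states at interior points. -/

section Entry

variable {C : ChargeData N} {A B : HiggsLattice.VecField P 0} {msq a : ℝ} {k K₀ : ℕ} {hL1 : 1 < P.L} {δ₁ Cst s δA δ₀ cv₀ cd₀ : ℝ}
  {Ω : Finset (HiggsLattice.Site P 0)}

/-- `W = G_k(Ω,Ã+B̃) − G_k(Ω,B̃)` read from the RIGHT on a region: `Wφ = G_k(Ω,Ã+B̃)V_kG_k(Ω,B̃)φ = (1.16)^Ω_{0,1}φ` ((I.3.44) on `Ω`, p40's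
`eq344_model_right`; `m² > 0`, `a > 0`, `k ≥ 1`, `L > 1`). [cite: Balaban1982Higgs1, (3.44) p.619] [cite: Balaban1983Higgs3, (1.16) p.414] -/
theorem W_apply_eq_op116_zero_one_region (hL : 1 < P.L) (hmsq : 0 < msq) (ha : 0 < a) (hk : 1 ≤ k) (φ : ScalarField P 0 N) :
    (propagatorK C Ω (A + B) msq a k - propagatorK C Ω B msq a k) φ = op116 C Ω A B msq a k 0 1 φ := by
  have hL' : (1 : ℝ) < (P.L : ℝ) := by exact_mod_cast hL
  have h344 := B3Eq116TwoSidedExpansion.eq344_model_right C Ω A B a k hmsq (B1.aSeq_pos ha hL' hk).le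
  have hW : (propagatorK C Ω (A + B) msq a k - propagatorK C Ω B msq a k)
      = propagatorK C Ω (A + B) msq a k * B3Eq116TwoSidedExpansion.opV C Ω A B msq a k * propagatorK C Ω B msq a k := by
    nth_rewrite 1 [h344]
    abel
  rw [hW, op116_succ_right_apply, op116_zero_zero_apply, Module.End.mul_apply, Module.End.mul_apply, B3Op116SourceForm.opV_apply_eq_srcV]

/-- `W` read from the LEFT on a region: `Wφ = G_k(Ω,B̃)V_kG_k(Ω,Ã+B̃)φ = (1.16)^Ω_{1,0}φ`. [cite: Balaban1982Higgs1, (3.44) p.619] [cite: Balaban1983Higgs3, (1.16) p.414] -/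
theorem W_apply_eq_op116_one_zero_region (hL : 1 < P.L) (hmsq : 0 < msq) (ha : 0 < a) (hk : 1 ≤ k) (φ : ScalarField P 0 N) :
    (propagatorK C Ω (A + B) msq a k - propagatorK C Ω B msq a k) φ = op116 C Ω A B msq a k 1 0 φ := by
  have hL' : (1 : ℝ) < (P.L : ℝ) := by exact_mod_cast hL
  have h344 := B3Eq116TwoSidedExpansion.eq344_model C Ω A B a k hmsq (B1.aSeq_pos ha hL' hk).le
  have hW : (propagatorK C Ω (A + B) msq a k - propagatorK C Ω B msq a k)
      = propagatorK C Ω B msq a k * B3Eq116TwoSidedExpansion.opV C Ω A B msq a k * propagatorK C Ω (A + B) msq a k := by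
    nth_rewrite 1 [h344]
    abel
  rw [hW, op116_succ_left_apply, op116_zero_zero_apply, Module.End.mul_apply, Module.End.mul_apply, B3Op116SourceForm.opV_apply_eq_srcV]

variable (hδ₁ : 0 < δ₁) (hδ₁1 : δ₁ ≤ 1) (hCst : 0 ≤ Cst)
  (h210B : (regRegionKernels hL1 C Ω B msq a k K₀).Ineq210 δ₁ Cst)
  (h210AB : (regRegionKernels hL1 C Ω (A + B) msq a k K₀).Ineq210 δ₁ Cst)
  (hmsq : 0 < msq) (ha : 0 < a) (hk : 1 ≤ k) (hkK : k ≤ P.K) (i₀ : Ix N)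
  (hs : 0 ≤ s) (hA : ∀ b : HiggsLattice.PBond P 0, |A b| ≤ s) (hδA : 0 ≤ δA)
  (hregA : ∀ (z : HiggsLattice.Site P 0) (μ ν : Fin P.d), |A ⟨z.shift ν, μ⟩ - A ⟨z, μ⟩| ≤ δA)
  (hAS : ∀ b : HiggsLattice.PBond P 0, A b ≠ 0 → DeepBlk k K₀ Ω b.src ∧ DeepBlk k K₀ Ω b.tgt)
  (hδ₀ : 0 < δ₀) (hδ₀1 : δ₀ ≤ δ₁) (hcv₀ : 0 ≤ cv₀) (hcd₀ : 0 ≤ cd₀)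
  (x' : HiggsLattice.Site P 0)
include hδ₁ hδ₁1 hCst h210B h210AB hmsq ha hk hkK i₀ hs hA hδA hregA hAS hδ₀ hδ₀1 hcv₀ hcd₀

omit hδ₁ hδ₁1 hCst h210B h210AB hmsq ha hk hkK i₀ hs hA hδA hregA hAS hδ₀ hδ₀1 hcv₀ hcd₀ in
/-- the region state `0` with literal exponents is the region state `0` of the recursion (`seqC_zero`). [cite: Balaban1983Higgs3, (2.10) p.426] -/
theorem state_zero_iff_region (φ : ScalarField P 0 N) :
    ((∀ y, Interior k K₀ Ω y → ‖φ y‖ ≤ maj P k cv₀ 2 δ₀ y x') ∧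
      (∀ b₀ : HiggsLattice.PBond P 0, Interior k K₀ Ω b₀.src → ‖covDeriv C B φ b₀‖ ≤ maj P k cd₀ 1 δ₀ b₀.src x')) ↔
    ((∀ y, Interior k K₀ Ω y → ‖φ y‖
          ≤ maj P k (cvAt P N C k a Cst s δA δ₀ cv₀ cd₀ 0) (2 + ((0 : ℕ) : ℝ)) (rateAt P N C k a Cst s δA δ₀ cv₀ cd₀ 0) y x') ∧
      (∀ b₀ : HiggsLattice.PBond P 0, Interior k K₀ Ω b₀.src → ‖covDeriv C B φ b₀‖
          ≤ maj P k (cdAt P N C k a Cst s δA δ₀ cv₀ cd₀ 0) (1 + ((0 : ℕ) : ℝ)) (rateAt P N C k a Cst s δA δ₀ cv₀ cd₀ 0) b₀.src x')) := by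
  obtain ⟨e1, e2, e3⟩ := seqC_zero (P := P) (N := N) (C := C) (k := k) (a := a) (Cst := Cst) (s := s) (δA := δA) (δ₀ := δ₀)
    (cv₀ := cv₀) (cd₀ := cd₀)
  rw [e1, e2, e3, Nat.cast_zero, add_zero, add_zero]

/-- `n′ = 0` on a region: if `G_k(Ω,Ã+B̃)ψ` is in the region state `J`, then `(1.16)^Ω_{n,0}ψ` is in the region state `J + n` (only `X = B̃`
steps). [cite: Balaban1983Higgs3, (1.16) p.414, (2.10) p.426, p.412] -/
theorem state_op116_zero_right_region : ∀ (n J : ℕ) (ψ : ScalarField P 0 N),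
    ((∀ y, Interior k K₀ Ω y → ‖propagatorK C Ω (A + B) msq a k ψ y‖
          ≤ maj P k (cvAt P N C k a Cst s δA δ₀ cv₀ cd₀ J) (2 + ((J : ℕ) : ℝ)) (rateAt P N C k a Cst s δA δ₀ cv₀ cd₀ J) y x') ∧
      (∀ b₀ : HiggsLattice.PBond P 0, Interior k K₀ Ω b₀.src → ‖covDeriv C B (propagatorK C Ω (A + B) msq a k ψ) b₀‖
          ≤ maj P k (cdAt P N C k a Cst s δA δ₀ cv₀ cd₀ J) (1 + ((J : ℕ) : ℝ)) (rateAt P N C k a Cst s δA δ₀ cv₀ cd₀ J) b₀.src x')) →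
    (∀ y, Interior k K₀ Ω y → ‖op116 C Ω A B msq a k n 0 ψ y‖
          ≤ maj P k (cvAt P N C k a Cst s δA δ₀ cv₀ cd₀ (J + n)) (2 + (((J + n) : ℕ) : ℝ)) (rateAt P N C k a Cst s δA δ₀ cv₀ cd₀ (J + n)) y x') ∧
      (∀ b₀ : HiggsLattice.PBond P 0, Interior k K₀ Ω b₀.src → ‖covDeriv C B (op116 C Ω A B msq a k n 0 ψ) b₀‖
          ≤ maj P k (cdAt P N C k a Cst s δA δ₀ cv₀ cd₀ (J + n)) (1 + (((J + n) : ℕ) : ℝ)) (rateAt P N C k a Cst s δA δ₀ cv₀ cd₀ (J + n)) b₀.src x') := by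
  intro n
  induction n with
  | zero =>
    intro J ψ hψ
    simp only [Nat.add_zero, op116_zero_zero_apply]
    exact hψ
  | succ n ihn =>
    intro J ψ hψ
    have ih := ihn J ψ hψ
    have e : J + (n + 1) = (J + n) + 1 := by omega
    rw [e]
    simp only [op116_succ_left_apply]
    exact step_state_region hδ₁ hδ₁1 hCst h210B h210AB hmsq ha hk hkK i₀ hs hA hδA hregA hAS hδ₀ hδ₀1 hcv₀ hcd₀ x' (J + n) _ ih.1 ih.2 B
      (Or.inl rfl)

/-- `n′ = 1` on a region: if `Wψ = G_k(Ω,Ã+B̃)V_kG_k(Ω,B̃)ψ` is in the region state `J`, then `(1.16)^Ω_{n,1}ψ` is in the region state `J + n`.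
[cite: Balaban1983Higgs3, (1.16) p.414, (2.10) p.426, p.412] -/
theorem state_op116_one_right_region (n J : ℕ) (ψ : ScalarField P 0 N)
    (hW : (∀ y, Interior k K₀ Ω y → ‖propagatorK C Ω (A + B) msq a k (srcV C A B k Ω a (propagatorK C Ω B msq a k ψ)) y‖
          ≤ maj P k (cvAt P N C k a Cst s δA δ₀ cv₀ cd₀ J) (2 + ((J : ℕ) : ℝ)) (rateAt P N C k a Cst s δA δ₀ cv₀ cd₀ J) y x') ∧
      (∀ b₀ : HiggsLattice.PBond P 0, Interior k K₀ Ω b₀.src →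
        ‖covDeriv C B (propagatorK C Ω (A + B) msq a k (srcV C A B k Ω a (propagatorK C Ω B msq a k ψ))) b₀‖
          ≤ maj P k (cdAt P N C k a Cst s δA δ₀ cv₀ cd₀ J) (1 + ((J : ℕ) : ℝ)) (rateAt P N C k a Cst s δA δ₀ cv₀ cd₀ J) b₀.src x')) :
    (∀ y, Interior k K₀ Ω y → ‖op116 C Ω A B msq a k n 1 ψ y‖
          ≤ maj P k (cvAt P N C k a Cst s δA δ₀ cv₀ cd₀ (J + n)) (2 + (((J + n) : ℕ) : ℝ)) (rateAt P N C k a Cst s δA δ₀ cv₀ cd₀ (J + n)) y x') ∧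
      (∀ b₀ : HiggsLattice.PBond P 0, Interior k K₀ Ω b₀.src → ‖covDeriv C B (op116 C Ω A B msq a k n 1 ψ) b₀‖
          ≤ maj P k (cdAt P N C k a Cst s δA δ₀ cv₀ cd₀ (J + n)) (1 + (((J + n) : ℕ) : ℝ)) (rateAt P N C k a Cst s δA δ₀ cv₀ cd₀ (J + n)) b₀.src x') := by
  have h := state_op116_zero_right_region hδ₁ hδ₁1 hCst h210B h210AB hmsq ha hk hkK i₀ hs hA hδA hregA hAS hδ₀ hδ₀1 hcv₀ hcd₀ x' n J _ hW
  simp only [op116_succ_right_apply]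
  exact h

/-- `n′ ≥ 2` (and every `n′ ≥ 1`) on a region: if both `G_k(Ω,X)V_kG_k(Ω,B̃)ψ`, `X ∈ {B̃, Ã+B̃}`, are in the region state `J`, then
`(1.16)^Ω_{n,n′+1}ψ` is in the region state `J + (n + n′)`. [cite: Balaban1983Higgs3, (1.16) p.414, (2.10) p.426, p.412] -/
theorem state_op116_succ_right_region (n' n J : ℕ) (ψ : ScalarField P 0 N)
    (hVG : ∀ X : HiggsLattice.VecField P 0, (X = B ∨ X = A + B) →
      (∀ y, Interior k K₀ Ω y → ‖propagatorK C Ω X msq a k (srcV C A B k Ω a (propagatorK C Ω B msq a k ψ)) y‖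
          ≤ maj P k (cvAt P N C k a Cst s δA δ₀ cv₀ cd₀ J) (2 + ((J : ℕ) : ℝ)) (rateAt P N C k a Cst s δA δ₀ cv₀ cd₀ J) y x') ∧
      (∀ b₀ : HiggsLattice.PBond P 0, Interior k K₀ Ω b₀.src →
        ‖covDeriv C B (propagatorK C Ω X msq a k (srcV C A B k Ω a (propagatorK C Ω B msq a k ψ))) b₀‖
          ≤ maj P k (cdAt P N C k a Cst s δA δ₀ cv₀ cd₀ J) (1 + ((J : ℕ) : ℝ)) (rateAt P N C k a Cst s δA δ₀ cv₀ cd₀ J) b₀.src x')) :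
    (∀ y, Interior k K₀ Ω y → ‖op116 C Ω A B msq a k n (n' + 1) ψ y‖
          ≤ maj P k (cvAt P N C k a Cst s δA δ₀ cv₀ cd₀ (J + (n + n'))) (2 + (((J + (n + n')) : ℕ) : ℝ))
            (rateAt P N C k a Cst s δA δ₀ cv₀ cd₀ (J + (n + n'))) y x') ∧
      (∀ b₀ : HiggsLattice.PBond P 0, Interior k K₀ Ω b₀.src → ‖covDeriv C B (op116 C Ω A B msq a k n (n' + 1) ψ) b₀‖
          ≤ maj P k (cdAt P N C k a Cst s δA δ₀ cv₀ cd₀ (J + (n + n'))) (1 + (((J + (n + n')) : ℕ) : ℝ))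
            (rateAt P N C k a Cst s δA δ₀ cv₀ cd₀ (J + (n + n'))) b₀.src x') := by
  have h := state_op116_region hδ₁ hδ₁1 hCst h210B h210AB hmsq ha hk hkK i₀ hs hA hδA hregA hAS hδ₀ hδ₀1 hcv₀ hcd₀ x' n' n J _ hVG
  simp only [op116_succ_right_apply]
  exact h

/-- LEFT ITERATION on a region: if `(1.16)^Ω_{n₀,n′}ψ` is in the region state `J`, then `(1.16)^Ω_{n₀+m,n′}ψ` is in the region state `J + m`.
[cite: Balaban1983Higgs3, (1.16) p.414, (2.10) p.426, p.412] -/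
theorem state_op116_add_left_region (n₀ n' : ℕ) : ∀ (m J : ℕ) (ψ : ScalarField P 0 N),
    ((∀ y, Interior k K₀ Ω y → ‖op116 C Ω A B msq a k n₀ n' ψ y‖
          ≤ maj P k (cvAt P N C k a Cst s δA δ₀ cv₀ cd₀ J) (2 + ((J : ℕ) : ℝ)) (rateAt P N C k a Cst s δA δ₀ cv₀ cd₀ J) y x') ∧
      (∀ b₀ : HiggsLattice.PBond P 0, Interior k K₀ Ω b₀.src → ‖covDeriv C B (op116 C Ω A B msq a k n₀ n' ψ) b₀‖
          ≤ maj P k (cdAt P N C k a Cst s δA δ₀ cv₀ cd₀ J) (1 + ((J : ℕ) : ℝ)) (rateAt P N C k a Cst s δA δ₀ cv₀ cd₀ J) b₀.src x')) →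
    (∀ y, Interior k K₀ Ω y → ‖op116 C Ω A B msq a k (n₀ + m) n' ψ y‖
          ≤ maj P k (cvAt P N C k a Cst s δA δ₀ cv₀ cd₀ (J + m)) (2 + (((J + m) : ℕ) : ℝ)) (rateAt P N C k a Cst s δA δ₀ cv₀ cd₀ (J + m)) y x') ∧
      (∀ b₀ : HiggsLattice.PBond P 0, Interior k K₀ Ω b₀.src → ‖covDeriv C B (op116 C Ω A B msq a k (n₀ + m) n' ψ) b₀‖
          ≤ maj P k (cdAt P N C k a Cst s δA δ₀ cv₀ cd₀ (J + m)) (1 + (((J + m) : ℕ) : ℝ)) (rateAt P N C k a Cst s δA δ₀ cv₀ cd₀ (J + m)) b₀.src x') := by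
  intro m
  induction m with
  | zero =>
    intro J ψ hψ
    simp only [Nat.add_zero]
    exact hψ
  | succ m ihm =>
    intro J ψ hψ
    have ih := ihm J ψ hψ
    have e : J + (m + 1) = (J + m) + 1 := by omega
    rw [e, show n₀ + (m + 1) = (n₀ + m) + 1 from rfl]
    simp only [op116_succ_left_apply]
    exact step_state_region hδ₁ hδ₁1 hCst h210B h210AB hmsq ha hk hkK i₀ hs hA hδA hregA hAS hδ₀ hδ₀1 hcv₀ hcd₀ x' (J + m) _ ih.1 ih.2 B
      (Or.inl rfl)

/-- **THE PURE-`B̃` CHAIN ON A REGION**: if `G_k(Ω,B̃)φ` is in the region state `J`, then `G_k(Ω,B̃)(V_kG_k(Ω,B̃))^mφ` is in the region state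
`J + m` (the region twin of `B3Op116HolderKernelRegularTorusZero.state_chainB`). [cite: Balaban1983Higgs3, (1.16) p.414, (2.10) p.426, p.412] -/
theorem state_chainB_region : ∀ (m J : ℕ) (φ : ScalarField P 0 N),
    ((∀ y, Interior k K₀ Ω y → ‖propagatorK C Ω B msq a k φ y‖
          ≤ maj P k (cvAt P N C k a Cst s δA δ₀ cv₀ cd₀ J) (2 + (J : ℝ)) (rateAt P N C k a Cst s δA δ₀ cv₀ cd₀ J) y x') ∧
      (∀ b₀ : HiggsLattice.PBond P 0, Interior k K₀ Ω b₀.src → ‖covDeriv C B (propagatorK C Ω B msq a k φ) b₀‖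
          ≤ maj P k (cdAt P N C k a Cst s δA δ₀ cv₀ cd₀ J) (1 + (J : ℝ)) (rateAt P N C k a Cst s δA δ₀ cv₀ cd₀ J) b₀.src x')) →
    (∀ y, Interior k K₀ Ω y → ‖propagatorK C Ω B msq a k
          ((fun ψ => srcV C A B k Ω a (propagatorK C Ω B msq a k ψ))^[m] φ) y‖
        ≤ maj P k (cvAt P N C k a Cst s δA δ₀ cv₀ cd₀ (J + m)) (2 + ((J + m : ℕ) : ℝ))
            (rateAt P N C k a Cst s δA δ₀ cv₀ cd₀ (J + m)) y x') ∧
    (∀ b₀ : HiggsLattice.PBond P 0, Interior k K₀ Ω b₀.src → ‖covDeriv C B (propagatorK C Ω B msq a k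
          ((fun ψ => srcV C A B k Ω a (propagatorK C Ω B msq a k ψ))^[m] φ)) b₀‖
        ≤ maj P k (cdAt P N C k a Cst s δA δ₀ cv₀ cd₀ (J + m)) (1 + ((J + m : ℕ) : ℝ))
            (rateAt P N C k a Cst s δA δ₀ cv₀ cd₀ (J + m)) b₀.src x') := by
  intro m
  induction m with
  | zero =>
    intro J φ hφ
    simp only [Function.iterate_zero, id_eq, Nat.add_zero]
    exact hφ
  | succ m ih =>
    intro J φ hφ
    have h1 := step_state_region hδ₁ hδ₁1 hCst h210B h210AB hmsq ha hk hkK i₀ hs hA hδA hregA hAS hδ₀ hδ₀1 hcv₀ hcd₀ x' J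
      (propagatorK C Ω B msq a k φ) hφ.1 hφ.2 B (Or.inl rfl)
    have h := ih (J + 1) (srcV C A B k Ω a (propagatorK C Ω B msq a k φ)) h1
    have e : J + (m + 1) = J + 1 + m := by omega
    rw [e, Function.iterate_succ_apply]
    exact h

end Entry

end Literature.MathematicalPhysics.QuantumFieldTheory.Balaban1983to89.B3Op116DKernelRegularRegion

end
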